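import Summits.CriticalPhenomena.SAWScalingLimit.Theorems.SAWDevelopingMapObservableToSLETypeLadderRotationSLE
import Literature.Probability.RandomPlanarGeometry.SLEConvergenceCriterion
import Mathlib.Topology.UniformSpace.HeineCantor
import HarnessLib

/-!
# Crux `SAWDevelopingMap.ObservableToSLE` (stmt-CriticalPhenomena-10472), line `six-class-type-ladder`,
stub T2b `stub_carvedReduction` (= twin stub 5a4 of stmt-CriticalPhenomena-14005): piece (G0),
WEAK LIMITS ALONG SEQUENCES AND MOVING TRANSLATIONS (the soft probabilistic bookkeeping)

Landing target:
`Summits/CriticalPhenomena/SAWScalingLimit/Theorems/SAWDevelopingMapObservableToSLETypeLadderCarvedReductionWeakLimit.lean`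
(`--supports stmt-CriticalPhenomena-10472`; registered sub-goal `stub_carvedReduction_slutsky`).

The moving-carving reduction argues by contradiction along a subsequence (`(G0)`): Prokhorov's
theorem extracts a weak limit of the conditioned Duminil-Copin–Smirnov laws in the PINNED frame,
the fixed-domain identification T2a identifies it, and the comparison with the original frame is
made through the lattice translations `τ_j → τ`.  This file supplies the generic pieces:

* `exists_strictMono_forall_of_not_eventually` — a property failing "eventually" fails along a
  subsequence;
* `exists_subseq_weakLimit` — Prokhorov along a sequence of eventually-probability measures on a
  Polish space which are eventually uniformly tight;
* translations `x ↦ x + w` acting on curve classes (`CurveClass.map` of `Homeomorph.addRight w`):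
  `dist_translate_translate_le` (moving the translation vector by `d` moves every class by `≤ d`),
  `continuous_translate_uncurry` (joint continuity), `translate_mem_modulusClass_iff`
  (injectivity-modulus events are translation invariant), `translate_translate`;
* `tendsto_integral_translate` — a SLUTSKY LEMMA: if `P_n ⇒ μ` weakly, the `P_n` are eventually
  uniformly tight and `w_n → w₀`, then `∫ f(x + w_n) dP_n(x) → ∫ f(x + w₀) dμ(x)` for bounded
  continuous `f` (uniform continuity of `f` on a compact set of translates);
* `stub_carvedReduction_slutsky` — the registered one-line packaging of the last item.

Sources: P. Billingsley, Convergence of Probability Measures (1999), Thm. 2.1, Thm. 3.1 (Slutsky),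
Thm. 5.1 (Prokhorov).
-/

noncomputable section

open scoped BigOperators Topology NNReal ENNReal Classical BoundedContinuousFunction
open Filter Set MeasureTheory Metric
open Literature.Probability.RandomPlanarGeometry

namespace Summit.CriticalPhenomena.SAWScalingLimit.Theorems.ObservableToSLE.TypeLadder

/-! ### Subsequences -/

/-- A property which does not hold eventually fails along a subsequence. -/
theorem exists_strictMono_forall_of_not_eventually {p : ℕ → Prop} (h : ¬ ∀ᶠ k in atTop, p k) :
    ∃ φ : ℕ → ℕ, StrictMono φ ∧ ∀ k, ¬ p (φ k) :=
  extraction_of_frequently_atTop (Filter.not_eventually.1 h)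

/-! ### Prokhorov along a sequence -/

section Prokhorov

variable {X : Type*} [MetricSpace X] [CompleteSpace X] [TopologicalSpace.SeparableSpace X]
  [MeasurableSpace X] [BorelSpace X]

/-- **Prokhorov along a sequence.**  A sequence of measures on a Polish space which are eventually
probability measures and eventually uniformly tight has a subsequence converging weakly to a
probability measure. [cite: BillingsleyCPM1999, Thm. 5.1] -/
theorem exists_subseq_weakLimit (P : ℕ → Measure X) (hP : ∀ᶠ n in atTop, IsProbabilityMeasure (P n))
    (ht : ∀ η : ℝ, 0 < η → ∃ K : Set X, IsCompact K ∧ ∀ᶠ n in atTop, P n Kᶜ ≤ ENNReal.ofReal η) :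
    ∃ (χ : ℕ → ℕ) (μ : Measure X), StrictMono χ ∧ IsProbabilityMeasure μ ∧
      ∀ g : X →ᵇ ℝ, Tendsto (fun i => ∫ x, g x ∂P (χ i)) atTop (𝓝 (∫ x, g x ∂μ)) := by
  obtain ⟨N, hN⟩ := eventually_atTop.1 hP
  have hN' : ∀ n, IsProbabilityMeasure (P (n + N)) := fun n => hN _ (N.le_add_left n)
  let ν : ℕ → ProbabilityMeasure X := fun n => ⟨P (n + N), hN' n⟩
  have htight : IsTightMeasureSet {((μ : ProbabilityMeasure X) : Measure X) | μ ∈ Set.range ν} := by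
    have hrange : {((μ : ProbabilityMeasure X) : Measure X) | μ ∈ Set.range ν} =
        Set.range (fun n => (ν n : Measure X)) := by
      ext x
      simp only [Set.mem_range, Set.mem_setOf_eq]
      constructor
      · rintro ⟨μ, ⟨n, rfl⟩, rfl⟩
        exact ⟨n, rfl⟩
      · rintro ⟨n, rfl⟩
        exact ⟨ν n, ⟨n, rfl⟩, rfl⟩
    rw [hrange]
    refine isTightMeasureSet_range_of_eventually fun ε hε => ?_
    rcases eq_or_ne ε ⊤ with rfl | hεtop
    · exact ⟨∅, isCompact_empty, Eventually.of_forall fun n => le_top⟩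
    obtain ⟨K, hK, hev⟩ := ht ε.toReal (ENNReal.toReal_pos hε.ne' hεtop)
    refine ⟨K, hK, ?_⟩
    have hev' := (tendsto_add_atTop_nat N).eventually hev
    filter_upwards [hev'] with n hn
    rw [ENNReal.ofReal_toReal hεtop] at hn
    exact hn
  have hcomp := isCompact_closure_of_isTightMeasureSet htight
  obtain ⟨μ, -, χ, hχ, hlim⟩ := hcomp.isSeqCompact fun n => subset_closure (Set.mem_range_self n)
  refine ⟨fun n => χ n + N, μ, fun a b hab => Nat.add_lt_add_right (hχ hab) N, inferInstance,
    fun g => ?_⟩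
  exact (ProbabilityMeasure.tendsto_iff_forall_integral_tendsto.1 hlim) g

end Prokhorov

/-! ### Translations acting on curve classes -/

/-- Moving the translation vector by `d` moves every translated curve class by at most `d`. -/
theorem dist_translate_translate_le (w w' : ℂ) (c : CurveClass ℂ) :
    dist (CurveClass.map ⟨Homeomorph.addRight w, (Homeomorph.addRight w).continuous⟩ c)
        (CurveClass.map ⟨Homeomorph.addRight w', (Homeomorph.addRight w').continuous⟩ c) ≤
      dist w w' := by
  obtain ⟨γ, rfl⟩ := CurveClass.surjective_mk c
  rw [CurveClass.map_mk, CurveClass.map_mk, CurveClass.dist_mk_mk]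
  refine (Curve.dist_le_dist_toContinuousMap _ _).trans ?_
  refine (ContinuousMap.dist_le dist_nonneg).2 fun t => ?_
  change dist (γ t + w) (γ t + w') ≤ dist w w'
  rw [dist_add_left]

/-- Translating by `w` is `1`-Lipschitz on curve classes. -/
theorem lipschitzWith_translate (w : ℂ) :
    LipschitzWith 1 (CurveClass.map ⟨Homeomorph.addRight w, (Homeomorph.addRight w).continuous⟩) :=
  CurveClass.lipschitzWith_map (f := ⟨Homeomorph.addRight w, (Homeomorph.addRight w).continuous⟩)
    (isometry_add_right w).lipschitz

/-- **Joint continuity** of `(c, w) ↦ c + w` on curve classes. -/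
theorem continuous_translate_uncurry :
    Continuous fun p : CurveClass ℂ × ℂ =>
      CurveClass.map ⟨Homeomorph.addRight p.2, (Homeomorph.addRight p.2).continuous⟩ p.1 := by
  refine Metric.continuous_iff.2 fun p ε hε => ⟨ε / 2, half_pos hε, fun p' hp' => ?_⟩
  have h1 := (lipschitzWith_translate p'.2).dist_le_mul p'.1 p.1
  have h2 := dist_translate_translate_le p'.2 p.2 p.1
  have hd1 : dist p'.1 p.1 ≤ dist p' p := by rw [Prod.dist_eq]; exact le_max_left _ _
  have hd2 : dist p'.2 p.2 ≤ dist p' p := by rw [Prod.dist_eq]; exact le_max_right _ _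
  simp only [NNReal.coe_one, one_mul] at h1
  calc dist (CurveClass.map ⟨Homeomorph.addRight p'.2, (Homeomorph.addRight p'.2).continuous⟩ p'.1)
        (CurveClass.map ⟨Homeomorph.addRight p.2, (Homeomorph.addRight p.2).continuous⟩ p.1)
      ≤ dist (CurveClass.map ⟨Homeomorph.addRight p'.2, (Homeomorph.addRight p'.2).continuous⟩ p'.1)
          (CurveClass.map ⟨Homeomorph.addRight p'.2, (Homeomorph.addRight p'.2).continuous⟩ p.1) +
        dist (CurveClass.map ⟨Homeomorph.addRight p'.2, (Homeomorph.addRight p'.2).continuous⟩ p.1)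
          (CurveClass.map ⟨Homeomorph.addRight p.2, (Homeomorph.addRight p.2).continuous⟩ p.1) :=
        dist_triangle _ _ _
    _ ≤ dist p' p + dist p' p := add_le_add (h1.trans hd1) (h2.trans hd2)
    _ < ε := by linarith

/-- **Translation invariance of the injectivity-modulus events.** -/
theorem translate_mem_modulusClass_iff (w : ℂ) (ε θ : ℝ) (c : CurveClass ℂ) :
    CurveClass.map ⟨Homeomorph.addRight w, (Homeomorph.addRight w).continuous⟩ c ∈
        CurveClass.modulusClass ε θ ↔ c ∈ CurveClass.modulusClass ε θ :=
  curveClassMap_mem_modulusClass_iff (Homeomorph.addRight w) (isometry_add_right w) ε θ c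

/-- Translations compose. -/
theorem translate_translate (w w' : ℂ) (c : CurveClass ℂ) :
    CurveClass.map ⟨Homeomorph.addRight w, (Homeomorph.addRight w).continuous⟩
        (CurveClass.map ⟨Homeomorph.addRight w', (Homeomorph.addRight w').continuous⟩ c) =
      CurveClass.map ⟨Homeomorph.addRight (w' + w), (Homeomorph.addRight (w' + w)).continuous⟩ c := by
  obtain ⟨γ, rfl⟩ := CurveClass.surjective_mk c
  rw [CurveClass.map_mk, CurveClass.map_mk, CurveClass.map_mk]
  exact congrArg CurveClass.mk (Curve.ext (ContinuousMap.ext fun t => (add_assoc _ _ _)))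

/-- The translation by `w` written as `z ↦ z + w` is the translation by `Homeomorph.addRight w`. -/
theorem curveClassMap_add_eq (w : ℂ) (h : Continuous fun z : ℂ => z + w) :
    CurveClass.map ⟨fun z : ℂ => z + w, h⟩ =
      CurveClass.map ⟨Homeomorph.addRight w, (Homeomorph.addRight w).continuous⟩ :=
  congrArg CurveClass.map (ContinuousMap.ext fun _ => rfl)

/-! ### A Slutsky lemma for moving translations -/

/-- **Slutsky lemma for moving translations.**  If `P_n ⇒ μ` weakly (bounded continuous test
functions), the `P_n` are eventually probability measures and eventually uniformly tight, and
`w_n → w₀`, then `∫ f(x + w_n) dP_n(x) → ∫ f(x + w₀) dμ(x)` for every bounded continuous `f`.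
[cite: BillingsleyCPM1999, Thm. 3.1] -/
theorem tendsto_integral_translate {P : ℕ → Measure (CurveClass ℂ)} {μ : Measure (CurveClass ℂ)}
    [IsProbabilityMeasure μ] (hP : ∀ᶠ n in atTop, IsProbabilityMeasure (P n))
    (hconv : ∀ g : CurveClass ℂ →ᵇ ℝ, Tendsto (fun n => ∫ x, g x ∂P n) atTop (𝓝 (∫ x, g x ∂μ)))
    (ht : ∀ η : ℝ, 0 < η → ∃ K : Set (CurveClass ℂ), IsCompact K ∧ ∀ᶠ n in atTop,
      P n Kᶜ ≤ ENNReal.ofReal η)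
    {w : ℕ → ℂ} {w₀ : ℂ} (hw : Tendsto w atTop (𝓝 w₀)) (f : CurveClass ℂ →ᵇ ℝ) :
    Tendsto (fun n => ∫ x, f (CurveClass.map ⟨Homeomorph.addRight (w n),
        (Homeomorph.addRight (w n)).continuous⟩ x) ∂P n) atTop
      (𝓝 (∫ x, f (CurveClass.map ⟨Homeomorph.addRight w₀, (Homeomorph.addRight w₀).continuous⟩ x) ∂μ)) := by
  -- the fixed translate `g₀ = f(· + w₀)` is bounded continuous
  set g₀ : CurveClass ℂ →ᵇ ℝ := f.compContinuous
    ⟨CurveClass.map ⟨Homeomorph.addRight w₀, (Homeomorph.addRight w₀).continuous⟩,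
      (lipschitzWith_translate w₀).continuous⟩ with hg₀
  have hg₀apply : ∀ x, g₀ x = f (CurveClass.map ⟨Homeomorph.addRight w₀,
      (Homeomorph.addRight w₀).continuous⟩ x) := fun x => rfl
  have hlim := hconv g₀
  simp only [hg₀apply] at hlim
  -- it suffices that the difference tends to `0`
  have hdiff : Tendsto (fun n => (∫ x, f (CurveClass.map ⟨Homeomorph.addRight (w n),
        (Homeomorph.addRight (w n)).continuous⟩ x) ∂P n) -
      ∫ x, f (CurveClass.map ⟨Homeomorph.addRight w₀, (Homeomorph.addRight w₀).continuous⟩ x) ∂P n)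
      atTop (𝓝 0) := by
    rw [Metric.tendsto_atTop]
    intro κ hκ
    -- a small auxiliary level
    obtain ⟨κ', hκ', hκ'le⟩ : ∃ κ' : ℝ, 0 < κ' ∧ κ' * (1 + 2 * ‖f‖) < κ :=
      ⟨κ / (2 * (1 + 2 * ‖f‖)), by positivity, by
        rw [div_mul_eq_mul_div, div_lt_iff₀ (by positivity)]; nlinarith [norm_nonneg f]⟩
    obtain ⟨K, hK, hPK⟩ := ht κ' hκ'
    -- uniform continuity of `f` on a compact set of translates
    set F : CurveClass ℂ × ℂ → CurveClass ℂ := fun p =>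
      CurveClass.map ⟨Homeomorph.addRight p.2, (Homeomorph.addRight p.2).continuous⟩ p.1 with hF
    have hK' : IsCompact (F '' (K ×ˢ closedBall w₀ 1)) :=
      (hK.prod (isCompact_closedBall w₀ 1)).image continuous_translate_uncurry
    obtain ⟨θ, hθ, hθf⟩ : ∃ θ > 0, ∀ y ∈ F '' (K ×ˢ closedBall w₀ 1), ∀ y' ∈ F '' (K ×ˢ closedBall w₀ 1),
        dist y y' < θ → dist (f y) (f y') < κ' := by
      have hu := hK'.uniformContinuousOn_of_continuous f.continuous.continuousOn
      rw [Metric.uniformContinuousOn_iff] at hu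
      obtain ⟨θ, hθ, h⟩ := hu κ' hκ'
      exact ⟨θ, hθ, fun y hy y' hy' hd => h y hy y' hy' hd⟩
    have hwev : ∀ᶠ n in atTop, dist (w n) w₀ < min θ 1 :=
      Metric.tendsto_nhds.1 hw (min θ 1) (lt_min hθ one_pos)
    obtain ⟨N, hN⟩ := eventually_atTop.1 (hP.and (hPK.and hwev))
    refine ⟨N, fun n hn => ?_⟩
    obtain ⟨hPn, hPnK, hwn⟩ := hN n hn
    haveI := hPn
    set h : CurveClass ℂ → ℝ := fun x => f (CurveClass.map ⟨Homeomorph.addRight (w n),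
        (Homeomorph.addRight (w n)).continuous⟩ x) -
      f (CurveClass.map ⟨Homeomorph.addRight w₀, (Homeomorph.addRight w₀).continuous⟩ x) with hh
    have hcont_n : Continuous fun x => f (CurveClass.map ⟨Homeomorph.addRight (w n),
        (Homeomorph.addRight (w n)).continuous⟩ x) :=
      f.continuous.comp (lipschitzWith_translate (w n)).continuous
    have hcont_0 : Continuous fun x => f (CurveClass.map ⟨Homeomorph.addRight w₀,
        (Homeomorph.addRight w₀).continuous⟩ x) :=
      f.continuous.comp (lipschitzWith_translate w₀).continuous
    have hbd_n : ∀ x, ‖f (CurveClass.map ⟨Homeomorph.addRight (w n),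
        (Homeomorph.addRight (w n)).continuous⟩ x)‖ ≤ ‖f‖ := fun x => f.norm_coe_le_norm _
    have hbd_0 : ∀ x, ‖f (CurveClass.map ⟨Homeomorph.addRight w₀,
        (Homeomorph.addRight w₀).continuous⟩ x)‖ ≤ ‖f‖ := fun x => f.norm_coe_le_norm _
    have hint_n : Integrable (fun x => f (CurveClass.map ⟨Homeomorph.addRight (w n),
        (Homeomorph.addRight (w n)).continuous⟩ x)) (P n) :=
      Integrable.of_bound hcont_n.aestronglyMeasurable ‖f‖ (Eventually.of_forall hbd_n)
    have hint_0 : Integrable (fun x => f (CurveClass.map ⟨Homeomorph.addRight w₀,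
        (Homeomorph.addRight w₀).continuous⟩ x)) (P n) :=
      Integrable.of_bound hcont_0.aestronglyMeasurable ‖f‖ (Eventually.of_forall hbd_0)
    have hint : Integrable h (P n) := hint_n.sub hint_0
    -- pointwise bounds for `h`
    have hsmall : ∀ x ∈ K, ‖h x‖ ≤ κ' := by
      intro x hx
      have hy : F (x, w n) ∈ F '' (K ×ˢ closedBall w₀ 1) :=
        ⟨(x, w n), ⟨hx, mem_closedBall.2 (hwn.le.trans (min_le_right _ _))⟩, rfl⟩
      have hy' : F (x, w₀) ∈ F '' (K ×ˢ closedBall w₀ 1) :=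
        ⟨(x, w₀), ⟨hx, mem_closedBall_self zero_le_one⟩, rfl⟩
      have hd : dist (F (x, w n)) (F (x, w₀)) < θ :=
        (dist_translate_translate_le (w n) w₀ x).trans_lt (hwn.trans_le (min_le_left _ _))
      have := hθf _ hy _ hy' hd
      rw [Real.dist_eq] at this
      exact this.le
    have hbig : ∀ x, ‖h x‖ ≤ 2 * ‖f‖ := fun x =>
      (norm_sub_le _ _).trans (by linarith [hbd_n x, hbd_0 x])
    rw [Real.dist_eq, sub_zero, ← integral_sub hint_n hint_0]
    change |∫ x, h x ∂P n| < κ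
    rw [← integral_add_compl (μ := P n) hK.isClosed.measurableSet hint]
    have h1 : ‖∫ x in K, h x ∂P n‖ ≤ κ' * (P n).real K :=
      norm_setIntegral_le_of_norm_le_const (measure_lt_top _ _) fun x hx => hsmall x hx
    have h2 : ‖∫ x in Kᶜ, h x ∂P n‖ ≤ 2 * ‖f‖ * (P n).real Kᶜ :=
      norm_setIntegral_le_of_norm_le_const (measure_lt_top _ _) fun x _ => hbig x
    have hPK1 : (P n).real K ≤ 1 := measureReal_le_one
    have hPK2 : (P n).real Kᶜ ≤ κ' := by
      rw [measureReal_def]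
      exact ENNReal.toReal_le_of_le_ofReal hκ'.le hPnK
    calc |∫ x in K, h x ∂P n + ∫ x in Kᶜ, h x ∂P n|
        ≤ ‖∫ x in K, h x ∂P n‖ + ‖∫ x in Kᶜ, h x ∂P n‖ := by
          rw [← Real.norm_eq_abs]; exact norm_add_le _ _
      _ ≤ κ' * 1 + 2 * ‖f‖ * κ' := add_le_add (h1.trans (mul_le_mul_of_nonneg_left hPK1 hκ'.le))
          (h2.trans (mul_le_mul_of_nonneg_left hPK2 (by positivity)))
      _ = κ' * (1 + 2 * ‖f‖) := by ring
      _ < κ := hκ'le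
  have := hdiff.add hlim
  simp only [zero_add, sub_add_cancel] at this
  exact this

/-- **Registered sub-goal `stub_carvedReduction_slutsky`** (crux item stmt-CriticalPhenomena-10472,
stub T2b `stub_carvedReduction`, piece (G0) SLUTSKY FOR MOVING TRANSLATIONS): weak convergence,
eventual tightness and `w_n → w₀` give `∫ f(x + w_n) dP_n → ∫ f(x + w₀) dμ`.
[cite: BillingsleyCPM1999, Thm. 3.1] -/
theorem stub_carvedReduction_slutsky :
    ∀ (P : ℕ → Measure (CurveClass ℂ)) (μ : Measure (CurveClass ℂ)) (w : ℕ → ℂ) (w₀ : ℂ)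
      (f : CurveClass ℂ →ᵇ ℝ), IsProbabilityMeasure μ →
      (∀ᶠ n in atTop, IsProbabilityMeasure (P n)) →
      (∀ g : CurveClass ℂ →ᵇ ℝ, Tendsto (fun n => ∫ x, g x ∂P n) atTop (𝓝 (∫ x, g x ∂μ))) →
      (∀ η : ℝ, 0 < η → ∃ K : Set (CurveClass ℂ), IsCompact K ∧ ∀ᶠ n in atTop,
        P n Kᶜ ≤ ENNReal.ofReal η) →
      Tendsto w atTop (𝓝 w₀) →
      Tendsto (fun n => ∫ x, f (CurveClass.map ⟨Homeomorph.addRight (w n),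
          (Homeomorph.addRight (w n)).continuous⟩ x) ∂P n) atTop
        (𝓝 (∫ x, f (CurveClass.map ⟨Homeomorph.addRight w₀,
          (Homeomorph.addRight w₀).continuous⟩ x) ∂μ)) := by
  intro P μ w w₀ f hμ hP hconv ht hw
  exact tendsto_integral_translate hP hconv ht hw f

end Summit.CriticalPhenomena.SAWScalingLimit.Theorems.ObservableToSLE.TypeLadder

end
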